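import Summits.CriticalPhenomena.PercolationContinuityZ3.Theorems.Transplant.TwoAxisParaCellsSkel
import HarnessLib

/-!
# N1 ({±1} node) file (C-2c) (hp-8 g31; answer to p1-g11's N1-RUN-RECORDS Q2): COARSE CONTAINMENT FROM THE RUN FRAME — an `(α, β′)`-box is read
# into a `ρ`-box: `ρ₁` depends on `β′` alone, and `n·λ₀ = A·(m·α − vα·β′)`, so `|Δα| ≤ a`, `|Δβ′| ≤ b` give `|Δρ₀| ≤ k₀` once `c·|A|·(|m|·a + |vα|·b) ≤ k₀·(n·D)`
# and `|Δρ₁| ≤ k₁` once `c·|A|·b ≤ k₁·D` (NEG-NODE-F-SCOPE §10.3/§12 (s4); p1-g11 N1-RUN-RECORDS (0.2): run records in exact `(α,β′)` coordinates, cells in `ρ`)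

builds on p205010 (kernel theorem, internal audit signed; external expert review pending) — nothing in this file uses p205010.
Lane `prim-bschramm`, seat `prim-hp-8` (gen 31); helper file (`--supports stmt-CriticalPhenomena-4575 --as helper`).
* `TwoAxis.Para.n_mul_lam0_eq` (`n·λ₀ = A(m·x₀ − vα·β′)`), `TwoAxis.Para.abs_coarse_sub_le_of_mul` (resolution lemma from `|c t − c t'| ≤ k·D`);
* **`Skelφ.coarse_containment_run`**: the `(α, β′)`-box → `ρ`-box reading at V-level (`relCoord φ t 0`, `shearCoord φ t n h`).
[cite: MartineauTassion2017, §4.3] [cite: KozmaNitzan2024, §4 Lemma 11 (pp. 22–23)]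
-/

namespace Summit.CriticalPhenomena.PercolationContinuityZ3.Theorems.Transplant

open Literature.Probability.LatticeModels

namespace TwoAxis.Para

/-- **`n·λ₀ = A·(m·α − vα·β′)`**: along the run frame the first dual coordinate is read from `α` and the sheared height only. [folklore] -/
theorem n_mul_lam0_eq (A n h vα vβ : ℤ) (x : Site 2) :
    n * lam0 A vα vβ x = A * (modulus n h vα vβ * x 0 - vα * bp n h x) := by
  unfold lam0 modulus bp; ring

/-- Coarse coordinates at resolution `k` from a scaled bound: `|c·t − c·t'| ≤ k·D` gives `|ρ t − ρ t'| ≤ k` (`0 < D`). [folklore] -/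
theorem abs_coarse_sub_le_of_mul {c s D t t' k : ℤ} (hD : 0 < D) (hct : |c * t - c * t'| ≤ k * D) :
    |coarse c s D t - coarse c s D t'| ≤ k := by
  rw [abs_le] at hct ⊢
  unfold coarse
  constructor
  · have h1 : c * t' + s ≤ c * t + s + k * D := by linarith [hct.1]
    have h2 := Int.ediv_le_ediv hD h1
    rw [Int.add_mul_ediv_right _ _ hD.ne'] at h2
    linarith
  · have h1 : c * t + s ≤ c * t' + s + k * D := by linarith [hct.2]
    have h2 := Int.ediv_le_ediv hD h1
    rw [Int.add_mul_ediv_right _ _ hD.ne'] at h2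
    linarith

end TwoAxis.Para

namespace Skelφ

variable {V : Type} {φ : V → Site 2}

/-- `α` of the relative position is `relCoord φ t 0`. [folklore] -/
theorem relφ_zero_eq_relCoord (t w : V) : relφ φ t w 0 = relCoord φ t 0 w := by
  simp [relφ, relCoord]

/-- `bp n h (relφ φ t w) = shearCoord φ t n h w`. [folklore] -/
theorem bp_relφ_eq_shearCoord (n : ℕ) (h : ℤ) (t w : V) : TwoAxis.Para.bp n h (relφ φ t w) = shearCoord φ t n h w := by
  simp [TwoAxis.Para.bp, relφ, shearCoord_apply]

/-- **COARSE CONTAINMENT FROM THE RUN FRAME** (p1-g11's Q2): if two vertices satisfy `|Δα| ≤ a` and `|Δβ′| ≤ b` (run coordinates `relCoord φ t 0`,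
`shearCoord φ t n h`), then their coarse positions differ by at most `k₀` along `u` and `k₁` across, as soon as `c·|A|·(|m|·a + |vα|·b) ≤ k₀·(n·D)` and
`c·|A|·b ≤ k₁·D` (`m = n·vβ − h·vα`, `0 < n`, `0 ≤ c`, `0 < D`) — the only reading of the run records into the ρ-cell complex. [cite: KozmaNitzan2024, §4 Lemma 11] -/
theorem coarse_containment_run (t : V) {A : ℤ} {n : ℕ} {h vα vβ c s₀ s₁ D a b k₀ k₁ : ℤ} (hn : 0 < n) (hc : 0 ≤ c) (hD : 0 < D)
    (hk0 : c * (|A| * (|TwoAxis.Para.modulus n h vα vβ| * a + |vα| * b)) ≤ k₀ * ((n : ℤ) * D)) (hk1 : c * (|A| * b) ≤ k₁ * D)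
    {w w' : V} (ha : |relCoord φ t 0 w - relCoord φ t 0 w'| ≤ a) (hb : |shearCoord φ t n h w - shearCoord φ t n h w'| ≤ b) :
    |coarseSkel φ t A n h vα vβ c s₀ s₁ D w 0 - coarseSkel φ t A n h vα vβ c s₀ s₁ D w' 0| ≤ k₀ ∧
      |coarseSkel φ t A n h vα vβ c s₀ s₁ D w 1 - coarseSkel φ t A n h vα vβ c s₀ s₁ D w' 1| ≤ k₁ := by
  have ha0 : 0 ≤ a := (abs_nonneg _).trans ha
  have hb0 : 0 ≤ b := (abs_nonneg _).trans hb
  set m := TwoAxis.Para.modulus n h vα vβ with hm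
  constructor
  · -- along: n·λ₀ = A(m α − vα β′)
    have e : (n : ℤ) * (TwoAxis.Para.lam0 A vα vβ (relφ φ t w) - TwoAxis.Para.lam0 A vα vβ (relφ φ t w')) =
        A * (m * (relCoord φ t 0 w - relCoord φ t 0 w') - vα * (shearCoord φ t n h w - shearCoord φ t n h w')) := by
      rw [mul_sub, TwoAxis.Para.n_mul_lam0_eq, TwoAxis.Para.n_mul_lam0_eq, bp_relφ_eq_shearCoord, bp_relφ_eq_shearCoord,
        relφ_zero_eq_relCoord, relφ_zero_eq_relCoord, ← hm]
      ring
    have hbound : (n : ℤ) * |TwoAxis.Para.lam0 A vα vβ (relφ φ t w) - TwoAxis.Para.lam0 A vα vβ (relφ φ t w')| ≤ |A| * (|m| * a + |vα| * b) := by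
      have : (n : ℤ) * |TwoAxis.Para.lam0 A vα vβ (relφ φ t w) - TwoAxis.Para.lam0 A vα vβ (relφ φ t w')| =
          |A * (m * (relCoord φ t 0 w - relCoord φ t 0 w') - vα * (shearCoord φ t n h w - shearCoord φ t n h w'))| := by
        rw [← e, abs_mul, abs_of_nonneg (by exact_mod_cast hn.le : (0 : ℤ) ≤ n)]
      rw [this, abs_mul]
      refine mul_le_mul_of_nonneg_left ?_ (abs_nonneg A)
      calc |m * (relCoord φ t 0 w - relCoord φ t 0 w') - vα * (shearCoord φ t n h w - shearCoord φ t n h w')|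
          ≤ |m * (relCoord φ t 0 w - relCoord φ t 0 w')| + |vα * (shearCoord φ t n h w - shearCoord φ t n h w')| := abs_sub _ _
        _ = |m| * |relCoord φ t 0 w - relCoord φ t 0 w'| + |vα| * |shearCoord φ t n h w - shearCoord φ t n h w'| := by rw [abs_mul, abs_mul]
        _ ≤ |m| * a + |vα| * b := by gcongr
    -- |c Δλ₀| ≤ k₀ D after dividing the scaled inequality by n
    have hct : |c * TwoAxis.Para.lam0 A vα vβ (relφ φ t w) - c * TwoAxis.Para.lam0 A vα vβ (relφ φ t w')| ≤ k₀ * D := by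
      rw [← mul_sub, abs_mul, abs_of_nonneg hc]
      have h3 : (n : ℤ) * (c * |TwoAxis.Para.lam0 A vα vβ (relφ φ t w) - TwoAxis.Para.lam0 A vα vβ (relφ φ t w')|) ≤ (n : ℤ) * (k₀ * D) := by
        calc (n : ℤ) * (c * |TwoAxis.Para.lam0 A vα vβ (relφ φ t w) - TwoAxis.Para.lam0 A vα vβ (relφ φ t w')|)
            = c * ((n : ℤ) * |TwoAxis.Para.lam0 A vα vβ (relφ φ t w) - TwoAxis.Para.lam0 A vα vβ (relφ φ t w')|) := by ring
          _ ≤ c * (|A| * (|m| * a + |vα| * b)) := mul_le_mul_of_nonneg_left hbound hc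
          _ ≤ k₀ * ((n : ℤ) * D) := hk0
          _ = (n : ℤ) * (k₀ * D) := by ring
      exact le_of_mul_le_mul_left h3 (by exact_mod_cast hn)
    exact TwoAxis.Para.abs_coarse_sub_le_of_mul hD hct
  · -- across: λ₁ = A β′
    have e : TwoAxis.Para.lam1 A n h (relφ φ t w) - TwoAxis.Para.lam1 A n h (relφ φ t w') =
        A * (shearCoord φ t n h w - shearCoord φ t n h w') := by
      rw [lam1_relφ_eq_shearCoord, lam1_relφ_eq_shearCoord]; ring
    have hl : |TwoAxis.Para.lam1 A n h (relφ φ t w) - TwoAxis.Para.lam1 A n h (relφ φ t w')| ≤ |A| * b := by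
      rw [e, abs_mul]; exact mul_le_mul_of_nonneg_left hb (abs_nonneg A)
    exact TwoAxis.Para.abs_coarse_sub_le hc hD hk1 hl

end Skelφ

end Summit.CriticalPhenomena.PercolationContinuityZ3.Theorems.Transplant
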